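import Literature.AlgebraicGeometry.Resolution.KnafKuhlmann2009Thm11
import Literature.AlgebraicGeometry.Resolution.SeparatingConstant
import Literature.AlgebraicGeometry.Resolution.InseparableLocalUniformizationDefectStep
import HarnessLib

/-!
# Height one is preserved in algebraic extensions of valued fields

Topic: `Literature/AlgebraicGeometry/Resolution` (valued fields). Plumbing for the assembly of
M. Temkin, *Inseparable local uniformization*, J. Algebra 373 (2013) 65–119 = arXiv:0804.1554v3,
Thm. 3.3.1 (tree: `Temkin2013RelativeCurveSmoothFibre`): the fact hypothesizes height one for
`k°` and `K°` only, while the chart datum of the algebraic proof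
(`RelCurveChart`, `RelativeCurveChartSetup.lean`) also records `ringKrullDim L₁° = 1` for the
finite extension `L₁ ⊇ K`. Classical (Bourbaki, *Alg. comm.* VI §8 no. 1: for `L|K` algebraic
the value group of an extension of `v` is contained in the divisible hull of `vK`, so the
heights agree): if `K₁|K` is algebraic and `K₁° ∩ K = K°` has Krull dimension `1`, then so has
`K₁°`. PROVED through the overrings: an overring `S ⊇ K₁°` containing `K` is all of `K₁`
(valuation rings are integrally closed), and one with `S ∩ K = K°` is `K₁°` itself (a value
`|y| > 1` with `y ∈ S` has a power equal to the value of an element of `K`, which then lies in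
`S ∩ K = K°`); a valuation ring whose only overrings are itself and the field has Krull
dimension `≤ 1` (`primeSpectrumEquiv`).

* `ValuationSubring.eq_top_of_forall_algebraMap_mem` — `S ⊇ K` & `K₁|K` algebraic ⇒ `S = K₁` — PROVED;
* `ValuationSubring.eq_or_eq_top_of_le_of_isAlgebraic` — the overrings of `K₁°` are `K₁°` and
  `K₁` when those of `K°` are `K°` and `K` — PROVED;
* `ValuationSubring.krullDimLE_one_of_overrings` — two overrings ⇒ Krull dimension `≤ 1` — PROVED;
* `ringKrullDim_eq_one_of_isAlgebraic` — **height one ascends along algebraic extensions** — PROVED.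

All statements are [folklore]; no definitions, no named facts.

## Sources

* N. Bourbaki, *Algèbre commutative* VI §8 no. 1 (Prop. 1) and §4 no. 3; folklore.
* M. Temkin, arXiv:0804.1554v3, §3.3 (the use: heights of `K₁°, L₁°` in Thm. 3.3.1).
-/

noncomputable section

open IsLocalRing

namespace Literature.AlgebraicGeometry.Resolution

universe u

variable {K K₁ : Type u} [Field K] [Field K₁] [Algebra K K₁]

omit [Algebra K K₁] in
/-- A valuation ring of Krull dimension `1` is not the whole field (local copy of
`valuationSubring_ne_top_of_ringKrullDim_eq_one`, `RelativeCurveAmbientHypotheses.lean`).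
[folklore] -/
private theorem ne_top_of_ringKrullDim_eq_one (O : ValuationSubring K)
    (hdim : ringKrullDim O = 1) : O ≠ ⊤ := by
  rintro rfl
  haveI : Ring.KrullDimLE 0 (⊤ : ValuationSubring K) := by
    refine Ring.KrullDimLE.mk₀ fun I hI => ?_
    rw [Ideal.isMaximal_iff]
    refine ⟨fun h1 => hI.ne_top ((Ideal.eq_top_iff_one I).mpr h1), fun J x hIJ hxI hxJ => ?_⟩
    have hx0 : (x : K) ≠ 0 := fun h0 => hxI (by
      have : x = 0 := Subtype.ext h0
      rw [this]; exact I.zero_mem)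
    have hunit : IsUnit x :=
      isUnit_of_inv_mem ⊤ x.2 (ValuationSubring.mem_top _) hx0
    exact J.eq_top_of_isUnit_mem hxJ hunit ▸ Submodule.mem_top
  have h0 : ringKrullDim (⊤ : ValuationSubring K) ≤ (0 : ℕ) := Ring.krullDimLE_iff.mp ‹_›
  rw [hdim] at h0
  exact absurd h0 (by norm_num)

/-- **An overring containing the ground field is everything** when the extension is algebraic:
valuation rings are integrally closed. [folklore] -/
theorem ValuationSubring.eq_top_of_forall_algebraMap_mem [Algebra.IsAlgebraic K K₁]
    (S : ValuationSubring K₁) (hK : ∀ c : K, algebraMap K K₁ c ∈ S) : S = ⊤ := by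
  refine eq_top_iff.mpr fun y _ => ?_
  exact mem_valuationSubring_of_isIntegral_of_forall_mem S hK
    (Algebra.IsAlgebraic.isAlgebraic y).isIntegral

/-- **The overrings of `K₁°` over a height-one `K°`**: if `K₁|K` is algebraic, `O₁` is a
valuation ring of `K₁` and every overring of `O = O₁ ∩ K` is `O` or `K`, then every overring
of `O₁` is `O₁` or `K₁`. [folklore] -/
theorem ValuationSubring.eq_or_eq_top_of_le_of_isAlgebraic [Algebra.IsAlgebraic K K₁]
    (O₁ : ValuationSubring K₁)
    (hO : ∀ S : ValuationSubring K, O₁.comap (algebraMap K K₁) ≤ S →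
      S = O₁.comap (algebraMap K K₁) ∨ S = ⊤)
    (S : ValuationSubring K₁) (hS : O₁ ≤ S) : S = O₁ ∨ S = ⊤ := by
  classical
  set O := O₁.comap (algebraMap K K₁) with hOdef
  have hle : O ≤ S.comap (algebraMap K K₁) := fun c hc => hS hc
  rcases hO _ hle with h | h
  · -- `S ∩ K = K°`: then `S = K₁°`
    left
    refine le_antisymm (fun y hyS => ?_) hS
    by_contra hy
    have hy0 : y ≠ 0 := fun h0 => hy (h0 ▸ O₁.zero_mem)
    -- a power of `y` has the value of an element of `K`
    have htors : IsValueTorsionOver O₁ (algebraMap K K₁).fieldRange ⊤ :=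
      isValueTorsionOver_of_isAlgebraic O₁ fun x _ => by
        have hx : IsAlgebraic K x := Algebra.IsAlgebraic.isAlgebraic x
        exact hx.ringHom_of_comp_eq (algebraMap K K₁).rangeRestrictField (RingHom.id K₁)
          (algebraMap K K₁).rangeRestrictField_bijective.1 (by ext; rfl)
    obtain ⟨n, hn, b, ⟨c, rfl⟩, hval⟩ := htors y (Subfield.mem_top y) hy0
    -- `c ∈ S ∩ K = O`, so `|y^n| = |c| ≤ 1`
    have hvy : 1 < O₁.valuation y := by
      rw [← not_le, O₁.valuation_le_one_iff]; exact hy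
    have hvyn0 : O₁.valuation (y ^ n) ≠ 0 := by
      rw [map_pow]; exact pow_ne_zero _ ((Valuation.ne_zero_iff _).mpr hy0)
    have hc0 : algebraMap K K₁ c ≠ 0 := fun h0 => by
      rw [h0, map_zero] at hval; exact hvyn0 hval
    have hu : algebraMap K K₁ c / y ^ n ∈ O₁ := by
      rw [← O₁.valuation_le_one_iff, map_div₀, ← hval, div_self hvyn0]
    have hcS : algebraMap K K₁ c ∈ S := by
      have : algebraMap K K₁ c = algebraMap K K₁ c / y ^ n * y ^ n := by
        rw [div_mul_cancel₀ _ (pow_ne_zero _ hy0)]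
      rw [this]
      exact mul_mem (hS hu) (pow_mem hyS n)
    have hcO : c ∈ O := by
      have : c ∈ S.comap (algebraMap K K₁) := hcS
      rwa [h] at this
    have hle1 : O₁.valuation (y ^ n) ≤ 1 := by
      rw [hval, O₁.valuation_le_one_iff]; exact hcO
    rw [map_pow] at hle1
    exact absurd (pow_le_one_iff_of_nonneg zero_le hn |>.mp hle1) (not_le.mpr hvy)
  · -- `S ⊇ K`: then `S = K₁`
    right
    refine ValuationSubring.eq_top_of_forall_algebraMap_mem (K := K) S fun c => ?_
    have : c ∈ S.comap (algebraMap K K₁) := by rw [h]; exact ValuationSubring.mem_top _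
    exact this

omit [Algebra K K₁] in
/-- **Two overrings ⇒ Krull dimension `≤ 1`**: a valuation ring whose only overrings are itself
and the field has Krull dimension at most one (primes ↔ overrings). [folklore] -/
theorem ValuationSubring.krullDimLE_one_of_overrings (O₁ : ValuationSubring K₁)
    (h2 : ∀ S : ValuationSubring K₁, O₁ ≤ S → S = O₁ ∨ S = ⊤) : Ring.KrullDimLE 1 O₁ := by
  refine Ring.KrullDimLE.mk₁' fun I hI0 hI => ?_
  haveI := hI
  have key : ∀ (S : ValuationSubring K₁) (hS : O₁ ≤ S), S = O₁ ∨ S = ⊤ →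
      ValuationSubring.idealOfLE O₁ S hS = ⊥ ∨ (ValuationSubring.idealOfLE O₁ S hS).IsMaximal := by
    intro S hS h
    rcases h with rfl | rfl
    · right
      rw [ValuationSubring.idealOfLE_self]
      exact IsLocalRing.maximalIdeal.isMaximal _
    · left
      exact ValuationSubring.idealOfLE_top _
  rcases key (O₁.ofPrime I) (O₁.le_ofPrime I) (h2 _ (O₁.le_ofPrime I)) with h | h
  · rw [ValuationSubring.idealOfLE_ofPrime] at h
    exact absurd h hI0
  · rw [ValuationSubring.idealOfLE_ofPrime] at h
    exact h

/-- **Height one ascends along algebraic extensions**: if `K₁|K` is algebraic and the valuation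
ring `O₁ ∩ K` of `K` has Krull dimension `1`, then `O₁` has Krull dimension `1`. [folklore] -/
theorem ringKrullDim_eq_one_of_isAlgebraic [Algebra.IsAlgebraic K K₁] (O₁ : ValuationSubring K₁)
    (hdim : ringKrullDim (O₁.comap (algebraMap K K₁)) = 1) : ringKrullDim O₁ = 1 := by
  set O := O₁.comap (algebraMap K K₁) with hOdef
  haveI : Ring.KrullDimLE 1 O := (Ring.krullDimLE_iff (R := O)).mpr (le_of_eq hdim)
  have hO_ne : O ≠ ⊤ := ne_top_of_ringKrullDim_eq_one O hdim
  have hO₁_ne : O₁ ≠ ⊤ := by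
    intro htop
    apply hO_ne
    refine eq_top_iff.mpr fun c _ => ?_
    show algebraMap K K₁ c ∈ O₁
    rw [htop]; exact ValuationSubring.mem_top _
  have h2 : ∀ S : ValuationSubring K₁, O₁ ≤ S → S = O₁ ∨ S = ⊤ :=
    ValuationSubring.eq_or_eq_top_of_le_of_isAlgebraic (K := K) O₁ fun S hS =>
      (_root_.ValuationSubring.eq_self_or_eq_top_of_le hS).imp Eq.symm id
  haveI := ValuationSubring.krullDimLE_one_of_overrings O₁ h2
  have hle : ringKrullDim O₁ ≤ 1 := by exact_mod_cast (Ring.krullDimLE_iff (R := O₁)).mp ‹_›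
  exact le_antisymm hle (one_le_ringKrullDim_of_ne_top O₁ hO₁_ne)

/-- The same for a finite extension `K₁ ⊇ K` with a valuation ring over a given `O` of height
one (the form of the hypotheses of Thm. 3.3.1). [folklore] -/
theorem ringKrullDim_eq_one_of_finiteDimensional [FiniteDimensional K K₁] {O : ValuationSubring K}
    (hdim : ringKrullDim O = 1) (O₁ : ValuationSubring K₁) (hO₁ : O₁.comap (algebraMap K K₁) = O) :
    ringKrullDim O₁ = 1 :=
  ringKrullDim_eq_one_of_isAlgebraic O₁ (by rw [hO₁]; exact hdim)

end Literature.AlgebraicGeometry.Resolution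

end
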